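import Mathlib
import Summits.QuantumFields.YangMills.Theses.ParabolicTrajectory
import Literature.MathematicalPhysics.QuantumFieldTheory.BalabanBanachStep
import Literature.Probability.LatticeModels.GibbsSpecification

/-!
# Sketch — crux-ideate stmt-QuantumFields-10522 (ContinuumLimitOnTrajectory), ideator 3, round 1

First lemmas of the three idea cards (cards 1–2 by gen 1 of this seat, card 3 by gen 2), stated over existing declarations only (need not be proved;
must elaborate).  Nothing here is filed as an item.
-/

namespace Summit.QuantumFields.YangMills.Cruxes.ContinuumLimitOnTrajectory.Sketch

open Filter MeasureTheory Topology
open scoped BoundedContinuousFunction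

/-! ## Card 1 (rp-moment-pin-fibre-slaving) -/

/-- **First lemma of card 1 (moment transfer): integer-time Laplace data pin every scale.**
`ν k` are the (finite, `[0,∞)`-supported) spectral measures of the curvature vector `P̂Ω_k` in
physical energy units; `∫ e^{-tE} dν_k` is the dimensionless curvature two-point function
`N_t(k)` at physical time separation `t`.  Hypothesis (i) of the crux gives convergence at every
integer `t ≥ 1`; a k-uniform bound at every real `s > 0` (the a-priori UV bound F3) upgrades this
to convergence at EVERY real `s > 0` (Müntz/Weierstrass on `λ = e^{-E} ∈ [0,1]`: the span of
`λ^{n-s₀}`, `n ≥ 1`, is dense in `C₀((0,1])`, and the weight `λ^{s-s₀}` kills escaping UV mass at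
`λ = 0`).  Pure Mathlib. -/
def LaplaceIntegerToReal : Prop :=
  ∀ (ν : ℕ → Measure ℝ), (∀ k, IsFiniteMeasure (ν k)) → (∀ k, ν k (Set.Iio 0) = 0) →
    (∀ t : ℕ, 0 < t → ∃ c : ℝ,
      Tendsto (fun k => ∫ E, Real.exp (-((t : ℝ) * E)) ∂(ν k)) atTop (𝓝 c)) →
    (∀ s : ℝ, 0 < s → ∃ B : ℝ, ∀ k, ∫ E, Real.exp (-(s * E)) ∂(ν k) ≤ B) →
    ∀ s : ℝ, 0 < s → ∃ c : ℝ,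
      Tendsto (fun k => ∫ E, Real.exp (-(s * E)) ∂(ν k)) atTop (𝓝 c)

/-- **Card 1, abstract slaving lemma (windowed fibre contraction, no invariant graph).**
Two finite orbit segments of the skew product `F(g,y) = (φ g y, Ψ g y)` of a `BalabanBanachStep`
that stay in the chart `[0,δ] × B̄_δ` for `m` steps and whose BASE coordinates are `ε`-close along
the whole window have FINAL fibre coordinates `(θ'^m · 2R + C' ε)`-close.  (Discrete Grönwall:
`e_{i+1} ≤ θ' e_i + 3Cδ ε` from `contraction` and `lipschitz_base`; `C' = 3Cδ/(1-θ')`.  The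
route's `ParabolicCentreCurve` — existence/uniqueness/attraction of an invariant graph — is not
needed: the base closeness is supplied by the DATA, hypothesis (i) of the crux, at every scale of
the window, via `LaplaceIntegerToReal` + a read-out.) -/
def WindowedSlaving : Prop :=
  ∀ (G : Type) [Group G] [TopologicalSpace G] [IsTopologicalGroup G] [CompactSpace G]
    [MeasurableSpace G] [BorelSpace G]
    (r : Literature.MathematicalPhysics.QuantumFieldTheory.LatticeRep G) (M : ℕ)
    (S : Literature.MathematicalPhysics.QuantumFieldTheory.BalabanBanachStep G r M),
    ∃ C' : ℝ, ∀ (m : ℕ) (ε : ℝ) (p q : ℝ × S.E), 0 ≤ ε →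
      (∀ i ≤ m, (S.F^[i] p).1 ∈ Set.Icc 0 S.δ ∧ ‖(S.F^[i] p).2‖ ≤ S.δ ∧
        (S.F^[i] q).1 ∈ Set.Icc 0 S.δ ∧ ‖(S.F^[i] q).2‖ ≤ S.δ ∧
        |(S.F^[i] p).1 - (S.F^[i] q).1| ≤ ε) →
      ‖(S.F^[m] p).2 - (S.F^[m] q).2‖ ≤ S.θ' ^ m * (2 * S.R) + C' * ε

/-- **Card 1, coupling read-out (the pin is a good coordinate on the marginal direction)** —
a PROPERTY OF THE INSTANCE, not a consequence of the structure's axioms: in the chart, the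
unit-scale curvature two-point function of the effective theory `(g, y)`, read through the
realisation functional `expect` on one fixed pair of disjointly supported test functions
(supported near `0` and near `e₀`, i.e. on the time axis), separates base points — bi-Lipschitz in
`g⁴` with a `y`-defect of relative size `‖y − y'‖` (one loop: `N ≈ κ_G g⁴ (1 + O(g²))`, so
`|g⁴ − g'⁴| ≤ K (|ΔN| + g⁴ ‖Δy‖)`).  The line asks the instance of `BalabanStepParabolic` to
carry it (`BalabanStepWithReadout` below strengthens the route's `Nonempty`). -/
def Readout {G : Type} [Group G] [TopologicalSpace G] [IsTopologicalGroup G] [CompactSpace G]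
    [MeasurableSpace G] [BorelSpace G]
    {r : Literature.MathematicalPhysics.QuantumFieldTheory.LatticeRep G} {M : ℕ}
    (S : Literature.MathematicalPhysics.QuantumFieldTheory.BalabanBanachStep G r M) : Prop :=
  ∃ (f₁ f₂ : SchwartzMap (EuclideanSpace ℝ (Fin 4)) ℝ) (K δ₁ : ℝ) (T₀ : ℕ), 0 < K ∧ 0 < δ₁ ∧
    Literature.MathematicalPhysics.AQFT.IsOffDiagonal
      (SchwartzMap.tensorFin 2 fun i => Literature.MathematicalPhysics.QuantumLattice.ofRealTest (![f₁, f₂] i)) ∧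
    ∀ (T : ℕ) (g g' : ℝ) (y y' : S.E), T₀ ≤ T → g ∈ Set.Ioc 0 δ₁ → g' ∈ Set.Ioc 0 δ₁ →
      ‖y‖ ≤ S.δ → ‖y'‖ ≤ S.δ →
      |g ^ 4 - g' ^ 4| ≤ K * (|S.expect (g, y) T 2 ![r.curvature, r.curvature] ![f₁, f₂] -
          S.expect (g', y') T 2 ![r.curvature, r.curvature] ![f₁, f₂]| + g ^ 4 * ‖y - y'‖)

/-- The line's version of the route dependency `BalabanStepParabolic`: an instance WITH read-out
(`Nonempty` strengthened to `∃ S, Readout S`).  Everything else card 1 needs from the instance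
is already a field of `BalabanBanachStep` (`contraction`, `remainder_basin`, `expect_step`,
`expect_wilson`, `continuousOn_expect`, `betaOf`, `yW`); the parabolic precision fields
(`lipschitz_base` for `φ`, the `o(g³)` control) are NOT used by the line. -/
def BalabanStepWithReadout : Prop :=
  ∀ (G : Type) [Group G] [TopologicalSpace G] [IsTopologicalGroup G] [CompactSpace G],
    Literature.MathematicalPhysics.QuantumFieldTheory.IsCompactSimpleLieGroup G →
    letI : MeasurableSpace G := borel G; haveI : BorelSpace G := ⟨rfl⟩;
    ∀ (r : Literature.MathematicalPhysics.QuantumFieldTheory.LatticeRep G), ∃ M₀ : ℕ, ∀ M : ℕ,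
      M₀ ≤ M → ∃ S : Literature.MathematicalPhysics.QuantumFieldTheory.BalabanBanachStep G r M,
        Readout S

/-! ## Card 2 (coupling-modulation-free-energy) -/

/-- **First lemma of card 2 (Vitali transfer): convergence of interaction free energies for REAL
modulation strengths plus k-uniform COMPLEX bounds gives convergence of every cumulant.**
`f k s` = the `k`-th lattice interaction free energy as a function of one complex modulation
strength `s` (the multi-strength version is the same statement in several variables). -/
def VitaliCumulantTransfer : Prop :=
  ∀ (f : ℕ → ℂ → ℂ) (ρ B : ℝ), 0 < ρ →
    (∀ k, DifferentiableOn ℂ (f k) (Metric.ball 0 ρ)) →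
    (∀ k, ∀ z ∈ Metric.ball (0 : ℂ) ρ, ‖f k z‖ ≤ B) →
    (∀ x : ℝ, |x| < ρ → ∃ c : ℂ, Tendsto (fun k => f k (x : ℂ)) atTop (𝓝 c)) →
    ∀ n : ℕ, ∃ c : ℂ, Tendsto (fun k => iteratedDeriv n (f k) 0) atTop (𝓝 c)

/-- **Card 2, the exact identity behind the transfer (abstract form): tilting a probability
measure by a bounded observable and differentiating the log-partition function twice returns the
connected correlation.**  With `μ` = Wilson's measure at `β_k` and `A, B` = plaquette sums
weighted by `f₁(a_k x)`, `f₂(a_k x)`, the tilted measure IS Wilson's measure with the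
plaquette-dependent coupling `β_k + s f₁(a_k x_p) + t f₂(a_k x_p)` (card 2, Dictionary). -/
def TiltedLogPartitionHessian : Prop :=
  ∀ (Ω : Type) [MeasurableSpace Ω] (μ : Measure Ω) [IsProbabilityMeasure μ] (A B : Ω → ℝ)
    (CA CB : ℝ), Measurable A → Measurable B → (∀ ω, |A ω| ≤ CA) → (∀ ω, |B ω| ≤ CB) →
    deriv (fun s : ℝ => deriv (fun t : ℝ =>
        Real.log (∫ ω, Real.exp (s * A ω + t * B ω) ∂μ)) 0) 0 =
      (∫ ω, A ω * B ω ∂μ) - (∫ ω, A ω ∂μ) * ∫ ω, B ω ∂μ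

/-! ## Card 3 (gibbs-closure-uniqueness) -/

section Card3

open Literature.Probability.LatticeModels

/-- **First lemma of card 3 (closure of the DLR relation; Georgii 2011 §4.4, Friedli–Velenik
2017 Ex. 6.32 / Thm 6.26, here for GENERAL specifications on a compact metrisable single-spin
space, kernels converging uniformly in the boundary condition).**  If `μ_k` is a Gibbs measure
for the specification `γ_k`, the kernels `γ_k Λ` converge to `γ' Λ` uniformly in the boundary
condition on bounded continuous functions, `γ'` is Feller (quasilocal), and `μ_k → μ'` weakly,
then `μ'` is a Gibbs measure for `γ'`.  (Proof, three lines: `∫ γ'_Λ f dμ' = lim ∫ γ'_Λ f dμ_k`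
by Feller + weak convergence, `= lim ∫ γ_kΛ f dμ_k` by uniform convergence, `= lim ∫ f dμ_k =
∫ f dμ'` by DLR for `μ_k`; bounded continuous functions determine finite Borel measures on the
compact metrisable `V → S`.)  In the line: `V` = bonds of the unit lattice `ℤ⁴`, `S = G`
(compact), `μ_k` = Wilson's measure at `(a_k, β_k)` block-averaged `n_k` times to the unit
lattice (an EXACT Gibbs measure for Bałaban's `k`-th effective density — his `T`-operation is the
DLR consistency), `γ_k` = the specification of that density, `γ'` = the specification of the
limit ("perfect") action at the pinned coupling. -/
def GibbsClosure : Prop :=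
  ∀ (V S : Type) [Countable V] [TopologicalSpace S] [CompactSpace S]
    [TopologicalSpace.MetrizableSpace S] [MeasurableSpace S] [BorelSpace S]
    (γ : ℕ → Specification V S) (γ' : Specification V S)
    (μ : ℕ → Measure (V → S)) (μ' : Measure (V → S)) [IsProbabilityMeasure μ'],
    (∀ k, IsSpecification (γ k)) → IsSpecification γ' →
    (∀ (Λ : Finset V) (f : (V → S) →ᵇ ℝ), Continuous fun η : V → S => ∫ σ, f σ ∂(γ' Λ η)) →
    (∀ k, IsGibbsMeasure (γ k) (μ k)) →
    (∀ (Λ : Finset V) (f : (V → S) →ᵇ ℝ),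
      Tendsto (fun k => ⨆ η : V → S, |(∫ σ, f σ ∂(γ k Λ η)) - ∫ σ, f σ ∂(γ' Λ η)|)
        atTop (𝓝 0)) →
    (∀ f : (V → S) →ᵇ ℝ, Tendsto (fun k => ∫ σ, f σ ∂(μ k)) atTop (𝓝 (∫ σ, f σ ∂μ'))) →
    IsGibbsMeasure γ' μ'

/-- **Card 3, "identify, don't track" (closure + uniqueness ⇒ FULL-sequence convergence;
Friedli–Velenik Lemma 6.30's argument one level up).**  On `ℤ^d` with compact metrisable spins:
translation-invariant Gibbs measures `μ_k ∈ 𝒢(γ_k)` with `γ_k → γ'` uniformly (as above), `γ'`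
Feller, and `γ'` admitting AT MOST ONE translation-invariant Gibbs measure, converge weakly along
the full sequence (to that measure).  (Compactness of probability measures on the compact
configuration space gives cluster points; each is translation invariant and, by `GibbsClosure`,
in `𝒢(γ')`; uniqueness identifies them.)  In the line this is the whole convergence mechanism:
no contraction, no invariant manifold, no continuity of expectations on a chart; the analytic
work is (UV) the uniform convergence of the effective specifications at the pinned coupling and
(IR) the uniqueness of the translation-invariant state of the perfect action. -/
def IdentifyDontTrack : Prop :=
  ∀ (d : ℕ) (S : Type) [TopologicalSpace S] [CompactSpace S] [TopologicalSpace.MetrizableSpace S]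
    [MeasurableSpace S] [BorelSpace S]
    (γ : ℕ → Specification (Site d) S) (γ' : Specification (Site d) S)
    (μ : ℕ → Measure (Site d → S)),
    (∀ k, IsSpecification (γ k)) → IsSpecification γ' →
    (∀ (Λ : Finset (Site d)) (f : (Site d → S) →ᵇ ℝ),
      Continuous fun η : Site d → S => ∫ σ, f σ ∂(γ' Λ η)) →
    (∀ k, IsGibbsMeasure (γ k) (μ k)) → (∀ k, IsTranslationInvariantMeasure (μ k)) →
    (∀ (Λ : Finset (Site d)) (f : (Site d → S) →ᵇ ℝ),
      Tendsto (fun k => ⨆ η : Site d → S, |(∫ σ, f σ ∂(γ k Λ η)) - ∫ σ, f σ ∂(γ' Λ η)|)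
        atTop (𝓝 0)) →
    (∀ ν ν' : Measure (Site d → S), IsGibbsMeasure γ' ν → IsGibbsMeasure γ' ν' →
      IsTranslationInvariantMeasure ν → IsTranslationInvariantMeasure ν' → ν = ν') →
    ∃ ν : Measure (Site d → S), IsGibbsMeasure γ' ν ∧ IsTranslationInvariantMeasure ν ∧
      ∀ f : (Site d → S) →ᵇ ℝ, Tendsto (fun k => ∫ σ, f σ ∂(μ k)) atTop (𝓝 (∫ σ, f σ ∂ν))

/-- **Card 3, the IR stub in Israel's form (Friedli–Velenik Prop. 6.91, both inequalities
attained): uniqueness of the translation-invariant expectation of a local observable `g` under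
`γ'` ⇔ differentiability at `0` of the pressure `ψ_g(t)` of `γ'` perturbed by `t ∑_x g∘θ_x`.**
Stated abstractly for a convex `ψ : ℝ → ℝ` bracketing the expectations: if every
translation-invariant Gibbs expectation of `g` lies in `[ψ'₋(0), ψ'₊(0)]` and both endpoints are
attained, then the expectations agree iff `ψ` is differentiable at `0`.  (Pure convex analysis;
the content of the line's IR stub `PerfectActionUnique` is the differentiability, to be fed by
hypothesis (ii): torus states that cluster uniformly in the volume are incompatible with the
phase mixtures a kink produces — Borgs–Kotecký for the PS regime; a bet in general.) -/
def IsraelCriterion : Prop :=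
  ∀ (ψ : ℝ → ℝ) (E : Set ℝ), ConvexOn ℝ Set.univ ψ → E.Nonempty →
    (∀ e ∈ E, derivWithin ψ (Set.Iic 0) 0 ≤ e ∧ e ≤ derivWithin ψ (Set.Ici 0) 0) →
    derivWithin ψ (Set.Iic 0) 0 ∈ E → derivWithin ψ (Set.Ici 0) 0 ∈ E →
    (E.Subsingleton ↔ DifferentiableAt ℝ ψ 0)

end Card3

end Summit.QuantumFields.YangMills.Cruxes.ContinuumLimitOnTrajectory.Sketch
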